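import Summits.ValiantsHypothesis.ValiantsHypothesis.Theorems.ForgivenCollisionsDepthThreeRungTools
import Summits.ValiantsHypothesis.ValiantsHypothesis.Theses.ForgivenCollisions

/-!
# `DepthThreeRung` (item stmt-ValiantsHypothesis-11568) — the homogeneous `ΣΠΣ` rung of route
# ForgivenCollisions

The item: if a homogeneous depth-three circuit `Σ_{a<s} ∏_{i<n} ℓ_{a,i}` (`ℓ_{a,i}` linear forms in
the `n²` variables `x_{r,c}`) is congruent to `per_n` modulo the collision ideal `J_r` (monomials
with a tripled line, or at least `r` doubled lines) and `r ≥ 1`, then `s ≥ binom(n, ⌊(r-1)/2⌋)`.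

Proof (Nisan–Wigderson 1996, Thm. 1, made garbage-immune). Put `j = ⌊(r-1)/2⌋`, so `2j < r`.
Index rows and columns of a matrix `N_f` by pairs `a = (A, B)` of `j`-subsets of `Fin n`
(`PairIdx n j` of the barrier file `PartialDerivativesDetPerm`); with `π_a = reprPerm a`
(`π_a(B) = A`) let `∂_a` be the iterated derivative along the rook placement
`{x_{π_a b, b} : b ∈ B}` and `β_b` the complementary placement `{x_{π_b i, i} : i ∉ B}`; set
`N_f[a, b] = coeff_{β_b} (∂_a f)`. Then

* `N_f[a,b] = (positive integer) · coeff_{β_b + α_a} f` (`coeff_iterPDeriv`), and the exponent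
  `β_b + α_a` has row counts `[i ∉ A'] + [i ∈ A]`, column counts `[c ∉ B'] + [c ∈ B]`: no tripled
  line and at most `|A \ A'| + |B \ B'| ≤ 2j < r` doubled lines, so it is NOT in `J_r`
  (`not_bad_entry`) and `f` has the permanent's coefficient there: `1` on the diagonal (a
  permutation monomial, factor `1`), `0` off the diagonal (some line is doubled). Hence
  `N_f = 1` (`minor_eq_one`), of rank `binom(n,j)²`.
* `N` is linear in `f`, and for one product gate `g = ∏ᵢ ℓᵢ` every `∂_a g` lies in the span of the
  `binom(n,j)` sub-products `∏_{i ∈ S} ℓᵢ`, `|S| = n - j`, so `rank N_g ≤ binom(n,j)`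
  (`rank_coeff_iterPDeriv_prod_le` in the tools file).

Therefore `binom(n,j)² ≤ s · binom(n,j)`, i.e. `s ≥ binom(n,j)` (trivial when `binom(n,j) = 0`).

## References

* N. Nisan, A. Wigderson, *Lower bounds on arithmetic circuits via partial derivatives*,
  Comput. Complexity 6 (1996/97), Thm. 1 [NisanWigderson1996].
-/

noncomputable section

-- `Summit.ValiantsHypothesis.ValiantsHypothesis.…` is the tree's single-conjunct layout (Sub = Summit).
set_option linter.dupNamespace false

namespace Summit.ValiantsHypothesis.ValiantsHypothesis.Theorems.ForgivenCollisionsDepthThreeRung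

open MvPolynomial Finset
open Literature.Computability.AlgebraicComplexity
open Literature.Barriers.ValiantsHypothesis

/-! ### Rook placements indexed by (row set, column set) -/

section Rook

variable {n j : ℕ}

/-- Membership in the graph of `π` over a column set `T`: `(r, c) ∈ {(π t, t) : t ∈ T}` iff
`c ∈ T` and `π c = r`. [folklore] -/
theorem mem_map_grEmb {π : Equiv.Perm (Fin n)} {T : Finset (Fin n)} {v : Fin n × Fin n} :
    v ∈ T.map (grEmb π) ↔ v.2 ∈ T ∧ π v.2 = v.1 := by
  constructor
  · intro h
    obtain ⟨t, ht, rfl⟩ := Finset.mem_map.1 h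
    exact ⟨ht, rfl⟩
  · rintro ⟨h1, h2⟩
    exact Finset.mem_map.2 ⟨v.2, h1, Prod.ext h2 rfl⟩

/-- `offGraph π B` is the graph of `π` over the complement of `B`. [folklore] -/
theorem offGraph_eq_map (π : Equiv.Perm (Fin n)) (B : Finset (Fin n)) :
    offGraph π B = Bᶜ.map (grEmb π) := rfl

/-- Row counts of the rook placement `{(π t, t) : t ∈ T}`: row `i` is hit iff `π⁻¹ i ∈ T`. [folklore] -/
theorem rowCount_sqfree_map (π : Equiv.Perm (Fin n)) (T : Finset (Fin n)) (i : Fin n) :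
    rowCount (sqfree (T.map (grEmb π))) i = if π.symm i ∈ T then 1 else 0 := by
  simp only [rowCount, sqfree_apply, mem_map_grEmb]
  rw [Finset.sum_eq_single (π.symm i)]
  · simp only [Equiv.apply_symm_apply, and_true]
  · intro c _ hc
    rw [if_neg]
    rintro ⟨-, h⟩
    apply hc
    rw [← h, Equiv.symm_apply_apply]
  · intro h
    exact absurd (Finset.mem_univ _) h

/-- Column counts of the rook placement `{(π t, t) : t ∈ T}`: column `c` is hit iff `c ∈ T`. [folklore] -/
theorem colCount_sqfree_map (π : Equiv.Perm (Fin n)) (T : Finset (Fin n)) (c : Fin n) :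
    colCount (sqfree (T.map (grEmb π))) c = if c ∈ T then 1 else 0 := by
  simp only [colCount, sqfree_apply, mem_map_grEmb]
  rw [Finset.sum_eq_single (π c)]
  · simp only [and_true]
  · intro r _ hr
    rw [if_neg]
    rintro ⟨-, h⟩
    exact hr h.symm
  · intro h
    exact absurd (Finset.mem_univ _) h

/-- For `a = (A, B)`, `reprPerm a` carries `B` onto `A`: `π⁻¹ i ∈ B ↔ i ∈ A`. [folklore] -/
theorem symm_mem_iff (a : PairIdx n j) (i : Fin n) : (reprPerm a).symm i ∈ a.2.1 ↔ i ∈ a.1.1 := by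
  rw [← Finset.mem_map_equiv, reprPerm_spec]

/-- The derivative list of `a = (A, B)`: the variables `x_{π b, b}`, `b ∈ B` (rows `A`, columns `B`),
is duplicate-free. [folklore] -/
theorem nodup_dlist (a : PairIdx n j) : ((a.2.1.toList).map (grEmb (reprPerm a))).Nodup :=
  (Finset.nodup_toList _).map (grEmb _).injective

/-- The derivative list of `a` has length `j`. [folklore] -/
theorem length_dlist (a : PairIdx n j) : ((a.2.1.toList).map (grEmb (reprPerm a))).length = j := by
  rw [List.length_map, Finset.length_toList, a.2.2]

/-- The derivative list of `a` enumerates the rook placement `{(π b, b) : b ∈ B}`. [folklore] -/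
theorem toFinset_dlist (a : PairIdx n j) :
    ((a.2.1.toList).map (grEmb (reprPerm a))).toFinset = a.2.1.map (grEmb (reprPerm a)) := by
  ext v
  simp [List.mem_toFinset, Finset.mem_map]

/-- Row counts of the exponent at entry `(a, b)` of the immune minor: complementary placement of
`b` plus placement of `a` hits row `i` `[i ∉ A'] + [i ∈ A]` times. [folklore] -/
theorem rowCount_entry (a b : PairIdx n j) (i : Fin n) :
    rowCount (sqfree (offGraph (reprPerm b) b.2.1) + sqfree (a.2.1.map (grEmb (reprPerm a)))) i =
      (if i ∉ b.1.1 then 1 else 0) + (if i ∈ a.1.1 then 1 else 0) := by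
  rw [rowCount_add, offGraph_eq_map, rowCount_sqfree_map, rowCount_sqfree_map]
  have hb := symm_mem_iff b i
  have ha := symm_mem_iff a i
  simp only [Finset.mem_compl, hb, ha]

/-- Column counts of the exponent at entry `(a, b)`: `[c ∉ B'] + [c ∈ B]`. [folklore] -/
theorem colCount_entry (a b : PairIdx n j) (c : Fin n) :
    colCount (sqfree (offGraph (reprPerm b) b.2.1) + sqfree (a.2.1.map (grEmb (reprPerm a)))) c =
      (if c ∉ b.2.1 then 1 else 0) + (if c ∈ a.2.1 then 1 else 0) := by
  rw [colCount_add, offGraph_eq_map, colCount_sqfree_map, colCount_sqfree_map]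
  simp only [Finset.mem_compl]

/-- **Immunity.** The exponent at entry `(a, b)` has no tripled line and at most `2j` doubled
lines, so it is not `Bad_r` once `2j < r`. [folklore] -/
theorem not_bad_entry {r : ℕ} (hr : 2 * j < r) (a b : PairIdx n j) :
    ¬ ((∃ i : Fin n, 3 ≤ rowCount (sqfree (offGraph (reprPerm b) b.2.1) +
          sqfree (a.2.1.map (grEmb (reprPerm a)))) i) ∨
       (∃ c : Fin n, 3 ≤ colCount (sqfree (offGraph (reprPerm b) b.2.1) +
          sqfree (a.2.1.map (grEmb (reprPerm a)))) c) ∨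
       r ≤ (Finset.univ.filter fun i : Fin n => 2 ≤ rowCount (sqfree (offGraph (reprPerm b) b.2.1) +
          sqfree (a.2.1.map (grEmb (reprPerm a)))) i).card +
         (Finset.univ.filter fun c : Fin n => 2 ≤ colCount (sqfree (offGraph (reprPerm b) b.2.1) +
          sqfree (a.2.1.map (grEmb (reprPerm a)))) c).card) := by
  have hrow : ∀ i, rowCount (sqfree (offGraph (reprPerm b) b.2.1) +
      sqfree (a.2.1.map (grEmb (reprPerm a)))) i ≤ 2 := fun i => by
    rw [rowCount_entry]; split_ifs <;> simp
  have hcol : ∀ c, colCount (sqfree (offGraph (reprPerm b) b.2.1) +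
      sqfree (a.2.1.map (grEmb (reprPerm a)))) c ≤ 2 := fun c => by
    rw [colCount_entry]; split_ifs <;> simp
  have hfr : (Finset.univ.filter fun i : Fin n => 2 ≤ rowCount (sqfree (offGraph (reprPerm b) b.2.1) +
      sqfree (a.2.1.map (grEmb (reprPerm a)))) i) ⊆ a.1.1 := by
    intro i hi
    rw [Finset.mem_filter, rowCount_entry] at hi
    by_contra h
    rw [if_neg h] at hi
    have := hi.2
    split_ifs at this <;> simp at this
  have hfc : (Finset.univ.filter fun c : Fin n => 2 ≤ colCount (sqfree (offGraph (reprPerm b) b.2.1) +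
      sqfree (a.2.1.map (grEmb (reprPerm a)))) c) ⊆ a.2.1 := by
    intro c hc
    rw [Finset.mem_filter, colCount_entry] at hc
    by_contra h
    rw [if_neg h] at hc
    have := hc.2
    split_ifs at this <;> simp at this
  rintro (⟨i, hi⟩ | ⟨c, hc⟩ | hcard)
  · have := hrow i; omega
  · have := hcol c; omega
  · have h1 := Finset.card_le_card hfr
    have h2 := Finset.card_le_card hfc
    rw [a.1.2] at h1
    rw [a.2.2] at h2
    omega

/-- On the diagonal the exponent is the permutation monomial of `reprPerm a`. [folklore] -/
theorem entry_self (a : PairIdx n j) :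
    sqfree (offGraph (reprPerm a) a.2.1) + sqfree (a.2.1.map (grEmb (reprPerm a))) =
      permMonomial (reprPerm a) := by
  rw [offGraph_eq_map]
  ext ⟨rr, cc⟩
  simp only [Finsupp.add_apply, sqfree_apply, mem_map_grEmb, Finset.mem_compl, permMonomial_apply]
  by_cases h1 : cc ∈ a.2.1 <;> by_cases h2 : (reprPerm a) cc = rr <;> simp [h1, h2]

/-- Off the diagonal the exponent is not a permutation monomial, so its coefficient in the
permanent vanishes. [folklore] -/
theorem coeff_perPoly_entry_of_ne {K : Type*} [CommRing K] {a b : PairIdx n j} (hab : a ≠ b) :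
    coeff (sqfree (offGraph (reprPerm b) b.2.1) + sqfree (a.2.1.map (grEmb (reprPerm a))))
      (perPoly (Fin n) K) = 0 := by
  by_contra hne
  obtain ⟨ρ, hρ⟩ := exists_permMonomial_eq_of_coeff_perPoly_ne_zero K hne
  apply hab
  have hA : a.1.1 = b.1.1 := by
    apply Finset.eq_of_subset_of_card_le _ (by rw [a.1.2, b.1.2])
    intro i hi
    by_contra hib
    have := rowCount_permMonomial ρ i
    rw [hρ, rowCount_entry, if_pos hib, if_pos hi] at this
    omega
  have hB : a.2.1 = b.2.1 := by
    apply Finset.eq_of_subset_of_card_le _ (by rw [a.2.2, b.2.2])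
    intro c hc
    by_contra hcb
    have := colCount_permMonomial ρ c
    rw [hρ, colCount_entry, if_pos hcb, if_pos hc] at this
    omega
  exact Prod.ext (Subtype.ext hA) (Subtype.ext hB)

/-- On the diagonal the derivative coefficient factor `∏ (β_v + 1)` equals `1`: the complementary
placement avoids the differentiated variables. [folklore] -/
theorem prod_factor_self {K : Type*} [CommRing K] (a : PairIdx n j) :
    ∏ v ∈ ((a.2.1.toList).map (grEmb (reprPerm a))).toFinset,
      (((sqfree (offGraph (reprPerm a) a.2.1)) v + 1 : ℕ) : K) = 1 := by
  rw [toFinset_dlist]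
  refine Finset.prod_eq_one fun v hv => ?_
  rw [mem_map_grEmb] at hv
  rw [sqfree_apply, if_neg, zero_add, Nat.cast_one]
  rw [mem_offGraph]
  exact fun h => h.1 hv.1

end Rook

/-! ### The identity minor and the theorem -/

section Main

variable {n j : ℕ}

/-- **The immune minor is the identity.** If `f` agrees with `per_n` at every exponent that is not
`Bad_r` and `2j < r`, then the `binom(n,j)² × binom(n,j)²` matrix of derivative coefficients
(rows: `∂` along the placement of `a`; columns: the complementary placement of `b`) is `1`.
[cite: NisanWigderson1996, Thm. 1] -/
theorem minor_eq_one {r : ℕ} (hr : 2 * j < r) (f : MvPolynomial (Fin n × Fin n) ℂ)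
    (hf : ∀ d : Fin n × Fin n →₀ ℕ, ¬ ((∃ i : Fin n, 3 ≤ rowCount d i) ∨
      (∃ c : Fin n, 3 ≤ colCount d c) ∨
      r ≤ (Finset.univ.filter fun i : Fin n => 2 ≤ rowCount d i).card +
        (Finset.univ.filter fun c : Fin n => 2 ≤ colCount d c).card) →
      coeff d f = coeff d (perPoly (Fin n) ℂ)) :
    (Matrix.of fun a b : PairIdx n j => coeff (sqfree (offGraph (reprPerm b) b.2.1))
      (iterPDeriv ((a.2.1.toList).map (grEmb (reprPerm a))) f)) = 1 := by
  ext a b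
  rw [Matrix.of_apply, coeff_iterPDeriv _ (nodup_dlist a), Matrix.one_apply]
  by_cases hab : a = b
  · subst hab
    rw [if_pos rfl, prod_factor_self, one_mul, toFinset_dlist, hf _ (not_bad_entry hr a a),
      entry_self, coeff_permMonomial_perPoly]
  · rw [if_neg hab, toFinset_dlist, hf _ (not_bad_entry hr a b), coeff_perPoly_entry_of_ne hab,
      mul_zero]

/-- **Item `DepthThreeRung` (stmt-ValiantsHypothesis-11568; card P2(a) of route ForgivenCollisions):**
a homogeneous `ΣΠΣ` circuit `Σ_{a<s} ∏_{i<n} ℓ_{a,i}` congruent to `per_n` modulo the collision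
ideal `J_r` has top fan-in `s ≥ binom(n, ⌊(r-1)/2⌋)` — the Nisan–Wigderson partial-derivative
bound made garbage-immune: with `j = ⌊(r-1)/2⌋` the immune minor of order-`j` derivative
coefficients is the identity of size `binom(n,j)²` (`minor_eq_one`), while each product gate
contributes rank `≤ binom(n,j)` (`rank_coeff_iterPDeriv_prod_le`). [cite: NisanWigderson1996, Thm. 1] -/
theorem depthThreeRung_proof :
    Summit.ValiantsHypothesis.ValiantsHypothesis.Theses.ForgivenCollisions.DepthThreeRung := by
  unfold Summit.ValiantsHypothesis.ValiantsHypothesis.Theses.ForgivenCollisions.DepthThreeRung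
  intro n r s c hr hmem
  set j := (r - 1) / 2 with hj
  by_cases hjn : n < j
  · rw [Nat.choose_eq_zero_of_lt hjn]
    exact Nat.zero_le _
  push Not at hjn
  have h2j : 2 * j < r := by omega
  -- coefficient agreement off `Bad_r`
  have hcoeff : ∀ d : Fin n × Fin n →₀ ℕ, ¬ ((∃ i : Fin n, 3 ≤ rowCount d i) ∨
      (∃ c : Fin n, 3 ≤ colCount d c) ∨
      r ≤ (Finset.univ.filter fun i : Fin n => 2 ≤ rowCount d i).card +
        (Finset.univ.filter fun c : Fin n => 2 ≤ colCount d c).card) →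
      coeff d (∑ a : Fin s, ∏ i : Fin n, ∑ v : Fin n × Fin n,
        c a i v • (X v : MvPolynomial (Fin n × Fin n) ℂ)) = coeff d (perPoly (Fin n) ℂ) := by
    intro d hd
    refine coeff_eq_of_sub_mem_span (Bad := fun d : Fin n × Fin n →₀ ℕ =>
      (∃ i : Fin n, 3 ≤ rowCount d i) ∨ (∃ c : Fin n, 3 ≤ colCount d c) ∨
      r ≤ (Finset.univ.filter fun i : Fin n => 2 ≤ rowCount d i).card +
        (Finset.univ.filter fun c : Fin n => 2 ≤ colCount d c).card) ?_ hmem hd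
    intro d d' hle hbad
    have hrw : ∀ i, rowCount d i ≤ rowCount d' i := fun i =>
      Finset.sum_le_sum fun c _ => hle (i, c)
    have hcl : ∀ c, colCount d c ≤ colCount d' c := fun c =>
      Finset.sum_le_sum fun i _ => hle (i, c)
    rcases hbad with ⟨i, hi⟩ | ⟨c, hc⟩ | hcard
    · exact Or.inl ⟨i, hi.trans (hrw i)⟩
    · exact Or.inr (Or.inl ⟨c, hc.trans (hcl c)⟩)
    · refine Or.inr (Or.inr (hcard.trans (Nat.add_le_add (Finset.card_le_card ?_)
        (Finset.card_le_card ?_))))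
      · intro i
        simp only [Finset.mem_filter, Finset.mem_univ, true_and]
        exact fun h => h.trans (hrw i)
      · intro c
        simp only [Finset.mem_filter, Finset.mem_univ, true_and]
        exact fun h => h.trans (hcl c)
  -- the immune minor
  set N : MvPolynomial (Fin n × Fin n) ℂ → Matrix (PairIdx n j) (PairIdx n j) ℂ := fun g =>
    Matrix.of fun a b : PairIdx n j => coeff (sqfree (offGraph (reprPerm b) b.2.1))
      (iterPDeriv ((a.2.1.toList).map (grEmb (reprPerm a))) g) with hN
  have hN1 : N (∑ a : Fin s, ∏ i : Fin n, ∑ v : Fin n × Fin n,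
      c a i v • (X v : MvPolynomial (Fin n × Fin n) ℂ)) = 1 := minor_eq_one h2j _ hcoeff
  have hNsum : N (∑ a : Fin s, ∏ i : Fin n, ∑ v : Fin n × Fin n,
      c a i v • (X v : MvPolynomial (Fin n × Fin n) ℂ)) =
      ∑ a : Fin s, N (∏ i : Fin n, ∑ v : Fin n × Fin n, c a i v • X v) := by
    ext p q
    simp only [hN, Matrix.of_apply, Matrix.sum_apply, iterPDeriv_sum, coeff_sum]
  have hrank1 : (N (∑ a : Fin s, ∏ i : Fin n, ∑ v : Fin n × Fin n,
      c a i v • (X v : MvPolynomial (Fin n × Fin n) ℂ))).rank = n.choose j * n.choose j := by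
    rw [hN1, Matrix.rank_one, Fintype.card_prod, Fintype.card_finset_len, Fintype.card_fin]
  have hrank2 : (N (∑ a : Fin s, ∏ i : Fin n, ∑ v : Fin n × Fin n,
      c a i v • (X v : MvPolynomial (Fin n × Fin n) ℂ))).rank ≤ s * n.choose j := by
    rw [hNsum]
    refine (rank_sum_le _ _).trans ?_
    calc ∑ a : Fin s, (N (∏ i : Fin n, ∑ v : Fin n × Fin n, c a i v • X v)).rank
        ≤ ∑ _a : Fin s, n.choose j := Finset.sum_le_sum fun a _ =>
          rank_coeff_iterPDeriv_prod_le hjn _ (c a) (fun i v => pderiv_linearForm (c a i) v)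
            _ length_dlist _
      _ = s * n.choose j := by simp
  have hle : n.choose j * n.choose j ≤ s * n.choose j := hrank1 ▸ hrank2
  by_cases h0 : n.choose j = 0
  · rw [h0]
    exact Nat.zero_le _
  · exact Nat.le_of_mul_le_mul_right hle (Nat.pos_of_ne_zero h0)

end Main

end Summit.ValiantsHypothesis.ValiantsHypothesis.Theorems.ForgivenCollisionsDepthThreeRung
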